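import Summits.QuantumFields.GaugeBoot.FluctuationBlockOps
import HarnessLib

/-!
# Fluctuations of Wilson loops, VI: the loop equation for centered block products (gauge-boot, ADDENDUM 32 part F)

HONEST FRAMING (cell `pub-gaugeboot`, page 1 of every file): the venture produces certified bounds
on lattice expectations at stated coupling, gauge group, dimension and torus size; NOT a mass gap,
NOT a continuum limit, NOT a string tension; NOT Yang–Mills-summit-bearing (barriers
`FixedCouplingUltralocality`, `PerturbativeInvisibility`).  Strong-coupling `SO(N)` lattice gauge theory with free boundary
condition (S. Chatterjee, Comm. Math. Phys. **366** (2019); S. Chatterjee, J. Jafarov, arXiv:1604.04777); nothing about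
four-dimensional continuum Yang–Mills or a mass gap.

## Content

★ `centered_equation` — the EXACT loop equation satisfied by the centered block products `G(B₀; C₁, …, C_m)` of part D, over
any commutative ring `R` with elements `x` (later `1/N`) and `b` (later `β`), for a moment functional `p` obeying the lane's
symmetrized master loop hierarchy in the form `|s|p(s) − SD s p = x(|s|p(s) + TW s p) + x²·ME s p` (permutation
invariant on genuine loop sequences):

`|σ| G(σ) − SD_{B₀} G − Σ_j SD_{C_j} G = x(|σ|G(σ) + TW_{B₀}G + Σ_j TW_{C_j}G)`
`  + x²( ME_{B₀}G + Σ_j ME_{C_j}G + Σ_j XM(B₀, C_j)[G(·; C_{≠j})] + Σ_{j<j'} XM(C_j, C_{j'})[G(B₀; M, C_{≠j,j'}) + p(M)·G(B₀; C_{≠j,j'})] )`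

— splittings, deformations, twistings and in-block mergers act on each block separately; a merger ACROSS two centered blocks
fuses them (plus the product term `p(M)·G` from the centering), a merger between the uncentered block and `C_j` absorbs `C_j`.
Proof: induction on the number of centered blocks through the recursion `G(B₀; C :: rest) = G(B₀ ++ C; rest) − p(C)G(B₀; rest)`,
the decomposition of the operators of the block `B₀ ++ C` (part E) and permutation invariance.  This is the algebraic core
of the Gaussian-fluctuation theorem: in the equation for an `m`-block product, the `x⁰` part is a homogeneous contraction-type
operator and every other term carries a factor `x` with `≥ m` blocks or `x²` with `≥ m − 2` blocks.

`[new (lane)]`; bookkeeping only.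
-/

noncomputable section

open Finset
open Literature.MathematicalPhysics.QuantumFieldTheory.Chatterjee2019LargeN

namespace Summit.QuantumFields.GaugeBoot

namespace StringDuality

variable {d : ℕ} {R : Type*} [CommRing R]

/-- Splitting an `if`-guarded difference with a scalar factor. [folklore] -/
theorem ite_sub_mul_eq (c : Prop) [Decidable c] (a k e : R) :
    (if c then a - k * e else 0) = (if c then a else 0) - k * (if c then e else 0) := by
  split_ifs <;> ring

/-- ★ **The loop equation of the centered block products.**  See the module docstring.
[cite: Chatterjee2019LargeN, Theorem 3.6 (the finite-N master loop equation, whose structure this reproduces blockwise)] -/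
theorem centered_equation (x b : R) (p : LoopSeq d → R)
    (SD TW ME : LoopSeq d → (LoopSeq d → R) → R) (XM : LoopSeq d → LoopSeq d → (LoopSeq d → R) → R)
    (hSD : ∀ (A : LoopSeq d) (g : LoopSeq d → R), SD A g =
      ((∑ o : InvIdx A, g (A.negSplitAt o)) - ∑ o : SameIdx A, g (A.posSplitAt o))
        + b * ((∑ o : DeformIdx A, g (A.negDeformAt o)) - ∑ o : DeformIdx A, g (A.posDeformAt o)))
    (hTW : ∀ (A : LoopSeq d) (g : LoopSeq d → R), TW A g =
      (∑ o : SameIdx A, g (A.negTwistAt o)) - ∑ o : InvIdx A, g (A.posTwistAt o))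
    (hME : ∀ (A : LoopSeq d) (g : LoopSeq d → R), ME A g =
      (∑ o : MergeIdx A, g (A.negMergeAt o)) - ∑ o : MergeIdx A, g (A.posMergeAt o))
    (hXM : ∀ (A B : LoopSeq d) (g : LoopSeq d → R), XM A B g =
      (∑ i : Fin A.length, ∑ j : Fin B.length,
          ∑ q : {xy : Fin (A.get i).length × Fin (B.get j).length // ((B.get j).get xy.2).1 = ((A.get i).get xy.1).1},
            (g (A.take i ++ LoopSeq.prune [Word.negMerge _ q.1.1 _ q.1.2] ++ A.drop (i + 1) ++ B.eraseIdx j)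
              - g (A.take i ++ LoopSeq.prune [Word.posMerge _ q.1.1 _ q.1.2] ++ A.drop (i + 1) ++ B.eraseIdx j)))
      + ∑ j : Fin B.length, ∑ i : Fin A.length,
          ∑ q : {xy : Fin (B.get j).length × Fin (A.get i).length // ((A.get i).get xy.2).1 = ((B.get j).get xy.1).1},
            (g (A.eraseIdx i ++ (B.take j ++ LoopSeq.prune [Word.negMerge _ q.1.1 _ q.1.2] ++ B.drop (j + 1)))
              - g (A.eraseIdx i ++ (B.take j ++ LoopSeq.prune [Word.posMerge _ q.1.1 _ q.1.2] ++ B.drop (j + 1)))))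
    (hp : ∀ s : LoopSeq d, IsLoopSeq s → s ≠ [] →
      (s.len : R) * p s - SD s p = x * ((s.len : R) * p s + TW s p) + x ^ 2 * ME s p)
    (hpPerm : ∀ s s' : LoopSeq d, IsLoopSeq s → s.Perm s' → p s = p s')
    {G : LoopSeq d → List (LoopSeq d) → R} (hG0 : ∀ B₀ : LoopSeq d, G B₀ [] = p B₀)
    (hGs : ∀ (B₀ C : LoopSeq d) (rest : List (LoopSeq d)), G B₀ (C :: rest) = G (B₀ ++ C) rest - p C * G B₀ rest) :
    ∀ (Cs : List (LoopSeq d)), (∀ C ∈ Cs, IsLoopSeq C ∧ C ≠ []) → ∀ B₀ : LoopSeq d, IsLoopSeq B₀ →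
      ((B₀.len + (Cs.map LoopSeq.len).sum : ℕ) : R) * G B₀ Cs
          - SD B₀ (fun A => G A Cs) - ∑ j : Fin Cs.length, SD (Cs.get j) (fun C' => G B₀ (Cs.set j C')) =
        x * (((B₀.len + (Cs.map LoopSeq.len).sum : ℕ) : R) * G B₀ Cs + TW B₀ (fun A => G A Cs)
              + ∑ j : Fin Cs.length, TW (Cs.get j) (fun C' => G B₀ (Cs.set j C')))
          + x ^ 2 * (ME B₀ (fun A => G A Cs) + (∑ j : Fin Cs.length, ME (Cs.get j) (fun C' => G B₀ (Cs.set j C')))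
              + (∑ j : Fin Cs.length, XM B₀ (Cs.get j) (fun M => G M (Cs.eraseIdx j)))
              + ∑ j : Fin Cs.length, ∑ j' : Fin Cs.length, if (j : ℕ) < j' then
                  XM (Cs.get j) (Cs.get j') (fun M => G B₀ ((Cs.set j M).eraseIdx j') + p M * G B₀ ((Cs.eraseIdx j').eraseIdx j))
                else 0) := by
  intro Cs
  induction Cs with
  | nil =>
    intro _ B₀ hB₀
    have z : ∀ f : Fin ([] : List (LoopSeq d)).length → R, ∑ j, f j = 0 := fun f => Fin.sum_univ_zero f
    simp only [z, List.map_nil, List.sum_nil, add_zero, sub_zero]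
    have e1 : SD B₀ (fun A => G A []) = SD B₀ p := SD_congr b SD hSD B₀ fun A => hG0 A
    have e2 : TW B₀ (fun A => G A []) = TW B₀ p := TW_congr TW hTW B₀ fun A => hG0 A
    have e3 : ME B₀ (fun A => G A []) = ME B₀ p := ME_congr ME hME B₀ fun A => hG0 A
    rw [e1, e2, e3, hG0]
    by_cases hne : B₀ = []
    · subst hne
      rw [SD_nil b SD hSD, TW_nil TW hTW, ME_nil ME hME]
      simp [LoopSeq.len_nil]
    · linear_combination hp B₀ hB₀ hne
  | cons C rest ih =>
    intro hCs B₀ hB₀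
    have hC : IsLoopSeq C := (hCs C (by simp)).1
    have hCne : C ≠ [] := (hCs C (by simp)).2
    have hrest : ∀ C' ∈ rest, IsLoopSeq C' ∧ C' ≠ [] := fun C' h => hCs C' (List.mem_cons_of_mem C h)
    have hrestL : ∀ C' ∈ rest, IsLoopSeq C' := fun C' h => (hrest C' h).1
    have hB₀n : ∀ l ∈ B₀, l ≠ [] := fun l hl => (hB₀ l hl).2
    have hCn : ∀ l ∈ C, l ≠ [] := fun l hl => (hC l hl).2
    have hBC : IsLoopSeq (B₀ ++ C) := isLoopSeq_append hB₀ hC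
    -- the three input equations
    have h1 := ih hrest (B₀ ++ C) hBC
    have h2 := ih hrest B₀ hB₀
    have h3 := hp C hC hCne
    -- ### the left/right sides at `(B₀; C :: rest)` reduced to the data of `h1`, `h2`, `h3`
    -- the value
    have hG : G B₀ (C :: rest) = G (B₀ ++ C) rest - p C * G B₀ rest := hGs B₀ C rest
    -- block-0 operators
    have eSD0 : SD B₀ (fun A => G A (C :: rest)) = SD B₀ (fun A => G (A ++ C) rest) - p C * SD B₀ (fun A => G A rest) := by
      rw [SD_congr b SD hSD B₀ (fun A => hGs A C rest), SD_sub b SD hSD, SD_mul_left b SD hSD]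
    have eTW0 : TW B₀ (fun A => G A (C :: rest)) = TW B₀ (fun A => G (A ++ C) rest) - p C * TW B₀ (fun A => G A rest) := by
      rw [TW_congr TW hTW B₀ (fun A => hGs A C rest), TW_sub TW hTW, TW_mul_left TW hTW]
    have eME0 : ME B₀ (fun A => G A (C :: rest)) = ME B₀ (fun A => G (A ++ C) rest) - p C * ME B₀ (fun A => G A rest) := by
      rw [ME_congr ME hME B₀ (fun A => hGs A C rest), ME_sub ME hME, ME_mul_left ME hME]
    -- block sums over `C :: rest`
    have eSDj : (∑ j : Fin (C :: rest).length, SD ((C :: rest).get j) (fun C' => G B₀ ((C :: rest).set j C'))) =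
        (SD C (fun C' => G (B₀ ++ C') rest) - SD C p * G B₀ rest)
          + ((∑ j : Fin rest.length, SD (rest.get j) (fun C' => G (B₀ ++ C) (rest.set j C')))
            - p C * ∑ j : Fin rest.length, SD (rest.get j) (fun C' => G B₀ (rest.set j C'))) := by
      rw [blockSum_cons SD (fun L => G B₀ L) C rest]
      congr 1
      · rw [SD_congr b SD hSD C (fun C' => hGs B₀ C' rest), SD_sub b SD hSD, SD_mul_right b SD hSD]
      · rw [Finset.mul_sum, ← Finset.sum_sub_distrib]
        refine Finset.sum_congr rfl fun j _ => ?_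
        rw [SD_congr b SD hSD _ (fun C' => hGs B₀ C (rest.set j C')), SD_sub b SD hSD, SD_mul_left b SD hSD]
    have eTWj : (∑ j : Fin (C :: rest).length, TW ((C :: rest).get j) (fun C' => G B₀ ((C :: rest).set j C'))) =
        (TW C (fun C' => G (B₀ ++ C') rest) - TW C p * G B₀ rest)
          + ((∑ j : Fin rest.length, TW (rest.get j) (fun C' => G (B₀ ++ C) (rest.set j C')))
            - p C * ∑ j : Fin rest.length, TW (rest.get j) (fun C' => G B₀ (rest.set j C'))) := by
      rw [blockSum_cons TW (fun L => G B₀ L) C rest]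
      congr 1
      · rw [TW_congr TW hTW C (fun C' => hGs B₀ C' rest), TW_sub TW hTW, TW_mul_right TW hTW]
      · rw [Finset.mul_sum, ← Finset.sum_sub_distrib]
        refine Finset.sum_congr rfl fun j _ => ?_
        rw [TW_congr TW hTW _ (fun C' => hGs B₀ C (rest.set j C')), TW_sub TW hTW, TW_mul_left TW hTW]
    have eMEj : (∑ j : Fin (C :: rest).length, ME ((C :: rest).get j) (fun C' => G B₀ ((C :: rest).set j C'))) =
        (ME C (fun C' => G (B₀ ++ C') rest) - ME C p * G B₀ rest)
          + ((∑ j : Fin rest.length, ME (rest.get j) (fun C' => G (B₀ ++ C) (rest.set j C')))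
            - p C * ∑ j : Fin rest.length, ME (rest.get j) (fun C' => G B₀ (rest.set j C'))) := by
      rw [blockSum_cons ME (fun L => G B₀ L) C rest]
      congr 1
      · rw [ME_congr ME hME C (fun C' => hGs B₀ C' rest), ME_sub ME hME, ME_mul_right ME hME]
      · rw [Finset.mul_sum, ← Finset.sum_sub_distrib]
        refine Finset.sum_congr rfl fun j _ => ?_
        rw [ME_congr ME hME _ (fun C' => hGs B₀ C (rest.set j C')), ME_sub ME hME, ME_mul_left ME hME]
    -- cross mergers with block 0
    have eXMj : (∑ j : Fin (C :: rest).length, XM B₀ ((C :: rest).get j) (fun M => G M ((C :: rest).eraseIdx j))) =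
        XM B₀ C (fun M => G M rest)
          + ((∑ j : Fin rest.length, XM B₀ (rest.get j) (fun M => G (M ++ C) (rest.eraseIdx j)))
            - p C * ∑ j : Fin rest.length, XM B₀ (rest.get j) (fun M => G M (rest.eraseIdx j))) := by
      rw [xmSum_cons XM G B₀ C rest]
      congr 1
      rw [Finset.mul_sum, ← Finset.sum_sub_distrib]
      refine Finset.sum_congr rfl fun j _ => ?_
      rw [XM_congr XM hXM _ _ (fun M => hGs M C (rest.eraseIdx j)), XM_sub XM hXM, XM_mul_left XM hXM]
    -- cross mergers between centered blocks
    have eXX : (∑ j : Fin (C :: rest).length, ∑ j' : Fin (C :: rest).length, if (j : ℕ) < j' then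
          XM ((C :: rest).get j) ((C :: rest).get j')
            (fun M => G B₀ ((((C :: rest).set j M)).eraseIdx j') + p M * G B₀ (((C :: rest).eraseIdx j').eraseIdx j))
          else 0) =
        (∑ j' : Fin rest.length, XM C (rest.get j') (fun M => G (B₀ ++ M) (rest.eraseIdx j')))
          + ((∑ j : Fin rest.length, ∑ j' : Fin rest.length, if (j : ℕ) < j' then
              XM (rest.get j) (rest.get j')
                (fun M => G (B₀ ++ C) ((rest.set j M).eraseIdx j') + p M * G (B₀ ++ C) ((rest.eraseIdx j').eraseIdx j))
              else 0)
            - p C * ∑ j : Fin rest.length, ∑ j' : Fin rest.length, if (j : ℕ) < j' then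
              XM (rest.get j) (rest.get j')
                (fun M => G B₀ ((rest.set j M).eraseIdx j') + p M * G B₀ ((rest.eraseIdx j').eraseIdx j))
              else 0) := by
      rw [doubleSum_cons C rest]
      congr 1
      · refine Finset.sum_congr rfl fun j' _ => ?_
        exact XM_congr XM hXM _ _ fun M => by
          show G B₀ (M :: rest.eraseIdx j') + p M * G B₀ (rest.eraseIdx j') = G (B₀ ++ M) (rest.eraseIdx j')
          rw [hGs]; ring
      · rw [Finset.mul_sum, ← Finset.sum_sub_distrib]
        refine Finset.sum_congr rfl fun j _ => ?_
        rw [Finset.mul_sum, ← Finset.sum_sub_distrib]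
        refine Finset.sum_congr rfl fun j' _ => ?_
        rw [← ite_sub_mul_eq]
        split_ifs
        · rw [← XM_mul_left XM hXM, ← XM_sub XM hXM]
          exact XM_congr XM hXM _ _ fun M => by
            show G B₀ (C :: (rest.set j M).eraseIdx j') + p M * G B₀ (C :: (rest.eraseIdx j').eraseIdx j) = _
            rw [hGs, hGs]; ring
        · rfl
    -- ### the operators of the block `B₀ ++ C` in `h1`
    have aSD : SD (B₀ ++ C) (fun A => G A rest) = SD B₀ (fun A => G (A ++ C) rest) + SD C (fun C' => G (B₀ ++ C') rest) :=
      SD_append b SD hSD hB₀n hCn _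
    have aTW : TW (B₀ ++ C) (fun A => G A rest) = TW B₀ (fun A => G (A ++ C) rest) + TW C (fun C' => G (B₀ ++ C') rest) :=
      TW_append TW hTW hB₀n hCn _
    have aME : ME (B₀ ++ C) (fun A => G A rest) =
        ME B₀ (fun A => G (A ++ C) rest) + ME C (fun C' => G (B₀ ++ C') rest) + XM B₀ C (fun A => G A rest) :=
      ME_append ME XM hME hXM hB₀n hCn _
    have aXM : (∑ j : Fin rest.length, XM (B₀ ++ C) (rest.get j) (fun M => G M (rest.eraseIdx j))) =
        (∑ j : Fin rest.length, XM B₀ (rest.get j) (fun M => G (M ++ C) (rest.eraseIdx j)))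
          + ∑ j : Fin rest.length, XM C (rest.get j) (fun M => G (B₀ ++ M) (rest.eraseIdx j)) := by
      rw [← Finset.sum_add_distrib]
      refine Finset.sum_congr rfl fun j _ => ?_
      exact XM_append_left XM hXM hB₀ hC (hrestL _ (List.get_mem rest j)) _
        (fun M M' hM hMM' => centered_perm₀ hG0 hGs hpPerm (rest.eraseIdx j)
          (fun C' hC' => hrestL C' (List.mem_of_mem_eraseIdx hC')) M M' hM hMM')
    -- ### assemble
    rw [hG, eSD0, eTW0, eME0, eSDj, eTWj, eMEj, eXMj, eXX]
    rw [aSD, aTW, aME, aXM] at h1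
    simp only [LoopSeq.len_append, List.map_cons, List.sum_cons, Nat.cast_add] at h1 h2 ⊢
    linear_combination h1 - p C * h2 - G B₀ rest * h3

end StringDuality

end Summit.QuantumFields.GaugeBoot

end
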